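import Summits.QuantumFields.YangMills.Theorems.UnitScaleTiltHistoryTailBoundedHeightLocal
import HarnessLib

/-!
# Crux `HistoryTailL` (stmt-QuantumFields-19936) — THE SEVERITY SANDWICH IN THE CRUDE LARGE-THRESHOLD REGIME
# (registered stub `SandwichDischarge.stub_sandwichLarge` of the ledger skeleton `Cruxes/HistoryTailL/Lines/sandwich_discharge.lean`,
# ideator line «sandwich_discharge» / route-QuantumFields-CovariantDischarge rev 3, signature VERBATIM)

Cell `ym3-torus` (YM ladder rung R3 = continuum SU(2) Yang–Mills on the three-torus; NOT the Clay problem), width seat `ym-ust-19936-w5` gen 13.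

THE STUB.  For every block size `L` there is `N₁` (here `N₁ = 39`, depending on nothing) such that for every profile `(b₀, p₀)`, every
ladder multiplier `Λ > 1`, there are `γ₁, C, c, N` with: for every family `F` with `F.L = L`, every coupling `0 < γ ≤ γ₁`, every ladder base `b`,
every cut-off `K`, free top `n` and height `j` in the COUPLED range `N₁·j + n ≤ K`, in the LARGE regime `1 < θ_{Λb}(K−j)`, and every plaquette `p`
of `T^{(j)}`, the Gibbs mass of the sandwich event «finer heights θ_b-small ∧ coarser heights θ_{Λb}-small ∧ `θ_b(K−j) ≤ |Ū^{j}(∂p) − 1|`» is at most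
`C·β_{K−j}^N·exp(−c·p(g_{K−j})(b₀)²)`.

THE PROOF (the card's «crude locality ∕ sup-Stokes» made exact with tree lemmas only).  In the large regime `θ_b(K−j) = θ_{Λb}(K−j)/Λ > Λ⁻¹`
(`pFun` is linear in `b`), so the event lies in the plain tail `{Λ⁻¹ ≤ |Ū^{j}(∂p) − 1|}` with an `O(1)` threshold.  The footprint lemma
`HistoryTailBoundedHeightLocal.gibbsK_real_event_le_sum_footprint` (local crude Prop. 1 of [Balaban1985Averaging] iterated `j` times; valid at EVERY
height) covers it by `≤ (81L³)^j` fine tails `{Λ⁻¹(151L²)^{−j} ≤ |U(∂q) − 1|}`, each bounded by the volume-uniform chessboard estimate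
`T3FinestHeightTail.gibbsMeasure_real_dist1_ge_le` ([FrohlichIsraelLiebSimon1978] Thm 4.1): `2e²⁴c₀⁻³(√β_K)⁹·exp(−β_K a²/4)`.  The COUPLING
`N₁·j + n ≤ K` (so `i := K − j ≥ 38j`) absorbs every `j`-dependence: `(81L³)^j·L^{5j} ≤ L^{15j} ≤ L^i ≤ β_i` and `(151L²)^{2j} ≤ L^{20j}`,
`L^{19j} ≤ √(L^i) ≤ √β_i`, whence the exponent is `≥ √β_i/(4Λ²)`; and `p(g_i)² = b₀²(1 + ½log β_i)^{2p₀} ≤ b₀²(8p₀)^{2p₀}e^{1/4}·β_i^{1/8}`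
(`x ≤ M·e^{x/M}`), which `√β_i` dominates once `β_i ≥ γ₁⁻¹ := Q³`, `Q := max 1 (4Λ²b₀²(8p₀)^{2p₀}e^{1/4})`.  Result: `C = 2e²⁴c₀⁻³`, `c = 1`, `N = 6`.

WHAT THIS IS NOT.  The crude regime only (threshold of unit size).  The load-bearing stub `stub_sandwichSweepGap` (small regime, the covariant
Cameron–Martin sweep) and the residual `stub_sandwichDeep` (`SandwichDeepWindowTailL`) stay OPEN; nothing of `HistoryTailL`, the rung R3, d = 4,
a continuum limit or a mass gap is proved here.  YM₃ on T³ is rung R3, NOT the Clay problem.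

References: T. Bałaban, CMP **98** (1985) 17–51 [Balaban1985Averaging] (Prop. 1 (51) p.26); CMP **102** (1985) 255–275 [Balaban1985UV3] ((3) p.256,
(7) p.257, (71) p.273); J. Fröhlich, R. Israel, E. Lieb, B. Simon, CMP 62 (1978) [FrohlichIsraelLiebSimon1978] (Thm 4.1).
-/

noncomputable section

open MeasureTheory
open scoped BigOperators
open Literature.MathematicalPhysics.QuantumFieldTheory.Balaban1983to89
open Literature.MathematicalPhysics.QuantumFieldTheory.Balaban1983to89.T3ContinuumYM3Torus
open Literature.MathematicalPhysics.QuantumFieldTheory.Balaban1983to89.T3UnitScaleTilt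
open Literature.MathematicalPhysics.QuantumFieldTheory.Balaban1983to89.T3UnitLawDensityEML
open Literature.MathematicalPhysics.QuantumFieldTheory.Balaban1983to89.T3FinestHeightTail
open Literature.MathematicalPhysics.QuantumFieldTheory.Balaban1983to89.T3Thresholds
open Summit.QuantumFields.YangMills.Theorems.HistoryTailBoundedHeight (one_le_lam lam_pos scheme_β_add one_le_scheme_β
  pow_le_scheme_β θBal_nonneg')
open Summit.QuantumFields.YangMills.Theorems.HistoryTailBoundedHeightLocal (card_planePairs gibbsK_real_event_le_sum_footprint)

namespace Summit.QuantumFields.YangMills.Theorems.CovariantDischargeSandwichLarge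

/-! ## §1 Real-arithmetic letters -/

section Letters

/-- `x ≤ M·e^{x/M}` for `M > 0` (from `1 + y ≤ e^y`). [folklore] -/
theorem le_mul_exp_div (x : ℝ) {M : ℝ} (hM : 0 < M) : x ≤ M * Real.exp (x / M) := by
  have h1 : x / M + 1 ≤ Real.exp (x / M) := Real.add_one_le_exp _
  have h2 : x = M * (x / M) := by field_simp
  calc x = M * (x / M) := h2
    _ ≤ M * (x / M + 1) := by
        apply mul_le_mul_of_nonneg_left _ hM.le
        linarith
    _ ≤ M * Real.exp (x / M) := mul_le_mul_of_nonneg_left h1 hM.le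

/-- A polynomial is below an exponential, with constants: `x^q ≤ M^q·exp(q·x/M)` for `x ≥ 0`, `q ≥ 0`, `M > 0` (real exponent). [folklore] -/
theorem rpow_le_mul_exp {x q M : ℝ} (hx : 0 ≤ x) (hq : 0 ≤ q) (hM : 0 < M) :
    x ^ q ≤ M ^ q * Real.exp (q * x / M) := by
  have h := le_mul_exp_div x hM
  have hE : 0 ≤ Real.exp (x / M) := (Real.exp_pos _).le
  calc x ^ q ≤ (M * Real.exp (x / M)) ^ q := Real.rpow_le_rpow hx h hq
    _ = M ^ q * Real.exp (x / M) ^ q := Real.mul_rpow hM.le hE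
    _ = M ^ q * Real.exp (q * x / M) := by
        congr 1
        rw [← Real.exp_mul]
        ring_nf

/-- `p(g)² ≤ b₀²(8p₀)^{2p₀}e^{1/4}·e^{t/8}` when `1 + log g⁻¹ = 1 + t/2` with `t ≥ 0` and `p₀ > 0`: the printed large-field exponent is
sub-polynomial in `β = e^t`. [cite: Balaban1985UV3, (7) p.257] -/
theorem pFun_sq_le {b₀ p₀ g t : ℝ} (hp₀ : 0 < p₀) (ht : 0 ≤ t) (hg : Real.log g⁻¹ = t / 2) :
    B10.pFun b₀ p₀ g ^ 2 ≤ b₀ ^ 2 * (8 * p₀) ^ (2 * p₀) * Real.exp (1 / 4) * Real.exp (t / 8) := by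
  unfold B10.pFun
  rw [hg]
  have hy : 0 < 1 + t / 2 := by linarith
  have hM : 0 < 8 * p₀ := by linarith
  have hq : 0 ≤ 2 * p₀ := by linarith
  -- `(y^{p₀})² = y^{2p₀}`
  have hsq : ((1 + t / 2) ^ p₀) ^ 2 = (1 + t / 2) ^ (2 * p₀) := by
    rw [sq, ← Real.rpow_add hy]; ring_nf
  have hmain : (1 + t / 2) ^ (2 * p₀) ≤ (8 * p₀) ^ (2 * p₀) * (Real.exp (1 / 4) * Real.exp (t / 8)) := by
    have h := rpow_le_mul_exp hy.le hq hM
    have hexp : Real.exp (2 * p₀ * (1 + t / 2) / (8 * p₀)) = Real.exp (1 / 4) * Real.exp (t / 8) := by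
      rw [← Real.exp_add]
      congr 1
      field_simp
      ring
    rwa [hexp] at h
  have hb : 0 ≤ b₀ ^ 2 := sq_nonneg _
  calc (b₀ * (1 + t / 2) ^ p₀) ^ 2 = b₀ ^ 2 * ((1 + t / 2) ^ p₀) ^ 2 := by ring
    _ = b₀ ^ 2 * (1 + t / 2) ^ (2 * p₀) := by rw [hsq]
    _ ≤ b₀ ^ 2 * ((8 * p₀) ^ (2 * p₀) * (Real.exp (1 / 4) * Real.exp (t / 8))) := mul_le_mul_of_nonneg_left hmain hb
    _ = b₀ ^ 2 * (8 * p₀) ^ (2 * p₀) * Real.exp (1 / 4) * Real.exp (t / 8) := by ring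

/-- `81·L⁸ ≤ L¹⁵` for `L ≥ 2` (`81 ≤ 2⁷`). [folklore] -/
theorem eightyone_mul_pow_le {L : ℝ} (hL : 2 ≤ L) : 81 * L ^ 3 * L ^ 5 ≤ L ^ 15 := by
  have h7 : (81 : ℝ) ≤ L ^ 7 := by
    have : (2 : ℝ) ^ 7 ≤ L ^ 7 := pow_le_pow_left₀ (by norm_num) hL 7
    nlinarith
  have h8 : 0 ≤ L ^ 8 := by positivity
  calc 81 * L ^ 3 * L ^ 5 = 81 * L ^ 8 := by ring
    _ ≤ L ^ 7 * L ^ 8 := mul_le_mul_of_nonneg_right h7 h8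
    _ = L ^ 15 := by ring

/-- `151·L² ≤ L¹⁰` for `L ≥ 2` (`151 ≤ 2⁸`). [folklore] -/
theorem lam_le_pow_ten {L : ℝ} (hL : 2 ≤ L) : 151 * L ^ 2 ≤ L ^ 10 := by
  have h8 : (151 : ℝ) ≤ L ^ 8 := by
    have : (2 : ℝ) ^ 8 ≤ L ^ 8 := pow_le_pow_left₀ (by norm_num) hL 8
    nlinarith
  have h2 : 0 ≤ L ^ 2 := by positivity
  calc 151 * L ^ 2 ≤ L ^ 8 * L ^ 2 := mul_le_mul_of_nonneg_right h8 h2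
    _ = L ^ 10 := by ring

/-- Bałaban's thresholds are linear in the profile constant: `θ_{c·b}(i) = c·θ_b(i)` (`p(g) = b(1 + log g⁻¹)^{p₀}`). [cite: Balaban1985UV3, (7) p.257] -/
theorem θBal_const_mul (L : ℕ) (γ c b p₀ : ℝ) (i : ℕ) : θBal L γ (c * b) p₀ i = c * θBal L γ b p₀ i := by
  rw [θBal_eq, θBal_eq]
  unfold B10.pFun
  ring

end Letters

/-! ## §2 The registered stub in the large regime -/

section Main

/-- **REGISTERED STUB `stub_sandwichLarge` (crude large-threshold regime of the severity sandwich), PROVED.**  For every `L` (with `N₁ = 39`), every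
profile `0 < b₀`, `2 < p₀`, ladder multiplier `1 < Λ`, there are `γ₁ ∈ (0,1]`, `C`, `c > 0`, `N` such that for every family `F` with `F.L = L`, every
`0 < γ ≤ γ₁`, every `b ≥ b₀`, every `K n j` with `1 ≤ j`, `N₁·j + n ≤ K`, in the regime `1 < θ_{Λb}(K−j)`, and every plaquette `p` of `T^{(j)}`:
`Gibbs_K{finer θ_b-small ∧ coarser θ_{Λb}-small ∧ θ_b(K−j) ≤ |Ū^{j}(∂p) − 1|} ≤ C·β_{K−j}^N·exp(−c·p(g_{K−j})(b₀)²)` — footprint locality of the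
`j`-fold average + the per-fine-plaquette chessboard tail + the coupling arithmetic (`C = 2e²⁴c₀⁻³`, `c = 1`, `N = 6`; see the file header).
[cite: Balaban1985Averaging, Prop. 1 (51) p.26; Balaban1985UV3, (3) p.256, (7) p.257 and (71) p.273; FrohlichIsraelLiebSimon1978, Thm 4.1] -/
theorem stub_sandwichLarge : ∀ (L : ℕ), ∃ N₁ : ℕ, 0 < N₁ ∧ ∀ (b₀ p₀ Λ : ℝ), 0 < b₀ → 2 < p₀ → 1 < Λ →
    ∃ (γ₁ C c : ℝ) (N : ℕ), 0 < γ₁ ∧ γ₁ ≤ 1 ∧ 0 < c ∧ ∀ (F : T3Family) (γ : ℝ), F.L = L → 0 < γ → γ ≤ γ₁ →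
      ∀ (b : ℝ), b₀ ≤ b → ∀ (K n j : ℕ), 1 ≤ j → N₁ * j + n ≤ K →
        1 < T3UnitScaleTilt.θBal F.L γ (Λ * b) p₀ (K - j) → ∀ p : Plaq (F.P K) j,
        (T3UnitScaleTilt.gibbsK F T3UnitLawDensityEML.ℰp γ K).real
          {U | (∀ k, k < j → PlaqSmall (T3UnitScaleTilt.θBal F.L γ b p₀ (K - k))
                (Averaging.iter (fun i => BlockAveraging.blockAvg (P := F.P K) (j := i) T3UnitLawDensityEML.ℰp) k U)) ∧
              (∀ j', j ≤ j' → j' + n ≤ K → PlaqSmall (T3UnitScaleTilt.θBal F.L γ (Λ * b) p₀ (K - j'))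
                (Averaging.iter (fun i => BlockAveraging.blockAvg (P := F.P K) (j := i) T3UnitLawDensityEML.ℰp) j' U)) ∧
              T3UnitScaleTilt.θBal F.L γ b p₀ (K - j) ≤ GaugeGroup.dist1 (GaugeField.plaqHol
                (Averaging.iter (fun i => BlockAveraging.blockAvg (P := F.P K) (j := i) T3UnitLawDensityEML.ℰp) j U) p)}
        ≤ C * ((γ * ((F.L : ℝ)⁻¹) ^ (K - j))⁻¹) ^ N *
            Real.exp (-(c * B10.pFun b₀ p₀ (Real.sqrt (γ * ((F.L : ℝ)⁻¹) ^ (K - j))) ^ 2)) := by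
  obtain ⟨c₀, hc₀, _, hch⟩ := gibbsMeasure_real_dist1_ge_le (N := 2)
  intro L
  refine ⟨39, by norm_num, fun b₀ p₀ Λ _hb₀ hp₀ hΛ => ?_⟩
  -- the constants
  set A : ℝ := b₀ ^ 2 * (8 * p₀) ^ (2 * p₀) * Real.exp (1 / 4) with hA
  set Q : ℝ := max 1 (4 * Λ ^ 2 * A) with hQ
  have hQ1 : 1 ≤ Q := le_max_left _ _
  have hQ0 : 0 < Q := one_pos.trans_le hQ1
  have hQA : 4 * Λ ^ 2 * A ≤ Q := le_max_right _ _
  refine ⟨(Q ^ 3)⁻¹, 2 * Real.exp 24 * (c₀ ^ 3)⁻¹, 1, 6, by positivity, inv_le_one_of_one_le₀ (one_le_pow₀ hQ1), one_pos,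
    fun F γ hFL hγ hγ1 b _hb K n j _hj hNK hreg p => ?_⟩
  subst hFL
  -- basic facts about the family
  have hLnat : 2 ≤ F.L := F.hL.2
  have hL2 : (2 : ℝ) ≤ F.L := by exact_mod_cast hLnat
  have hL1 : (1 : ℝ) ≤ F.L := by linarith
  have hL1n : 1 ≤ F.L := by omega
  have hγ1' : γ ≤ 1 := hγ1.trans (inv_le_one_of_one_le₀ (one_le_pow₀ hQ1))
  haveI := isProbabilityMeasure_gibbsK F ℰp hγ.le K
  -- names
  set i : ℕ := K - j with hi
  have hij : 38 * j ≤ i := by omega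
  have hjK : j ≤ K := by omega
  have hK : K = i + j := by omega
  set βi : ℝ := (F.scheme ℰp γ).β i with hβi
  set βK : ℝ := (F.scheme ℰp γ).β K with hβK
  have hβi_eq : βi = (γ * ((F.L : ℝ)⁻¹) ^ i)⁻¹ := rfl
  set x : ℝ := γ * ((F.L : ℝ)⁻¹) ^ i with hx
  have hx0 : 0 < x := by positivity
  have hxle : x ≤ γ := by
    have h1 : ((F.L : ℝ)⁻¹) ^ i ≤ 1 := pow_le_one₀ (inv_nonneg.mpr (by positivity)) (inv_le_one_of_one_le₀ hL1)
    calc x = γ * ((F.L : ℝ)⁻¹) ^ i := rfl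
      _ ≤ γ * 1 := mul_le_mul_of_nonneg_left h1 hγ.le
      _ = γ := mul_one γ
  set pg : ℝ := B10.pFun b₀ p₀ (Real.sqrt x) with hpg
  have hβKeq : βK = (F.L : ℝ) ^ j * βi := by rw [hβK, hK, scheme_β_add]
  have hβi1 : 1 ≤ βi := one_le_scheme_β F hγ hγ1' i
  have hβi0 : 0 < βi := one_pos.trans_le hβi1
  have hβK1 : 1 ≤ βK := one_le_scheme_β F hγ hγ1' K
  have hLi_le : (F.L : ℝ) ^ i ≤ βi := pow_le_scheme_β F hγ hγ1' i
  -- `βi ≥ γ⁻¹ ≥ Q³`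
  have hβiQ : Q ^ 3 ≤ βi := by
    have h1 : γ⁻¹ ≤ βi := by
      rw [hβi_eq]
      exact inv_anti₀ hx0 hxle
    have h2 : Q ^ 3 ≤ γ⁻¹ := by
      rw [le_inv_comm₀ (by positivity) hγ]
      exact hγ1
    exact h2.trans h1
  -- the thresholds: `θ_{Λb} = Λ·θ_b > 1`, so `Λ⁻¹ < θ_b`
  set θb : ℝ := θBal F.L γ b p₀ i with hθb
  have hΛ0 : 0 < Λ := one_pos.trans hΛ
  have hθb_gt : Λ⁻¹ < θb := by
    rw [θBal_const_mul] at hreg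
    rw [inv_lt_iff_one_lt_mul₀ hΛ0]
    linarith
  set θ₀ : ℝ := Λ⁻¹ with hθ₀
  have hθ₀0 : 0 ≤ θ₀ := inv_nonneg.mpr hΛ0.le
  have hθ₀1 : θ₀ ≤ 1 := inv_le_one_of_one_le₀ hΛ.le
  have hθ₀2 : θ₀ ≤ 2 := hθ₀1.trans (by norm_num)
  -- Step 1: the sandwich event lies in the plain `O(1)`-threshold tail
  have hsub : {U : GaugeField (F.P K) 0 (Matrix.specialUnitaryGroup (Fin 2) ℂ) |
        (∀ k, k < j → PlaqSmall (T3UnitScaleTilt.θBal F.L γ b p₀ (K - k))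
          (Averaging.iter (fun i => BlockAveraging.blockAvg (P := F.P K) (j := i) T3UnitLawDensityEML.ℰp) k U)) ∧
        (∀ j', j ≤ j' → j' + n ≤ K → PlaqSmall (T3UnitScaleTilt.θBal F.L γ (Λ * b) p₀ (K - j'))
          (Averaging.iter (fun i => BlockAveraging.blockAvg (P := F.P K) (j := i) T3UnitLawDensityEML.ℰp) j' U)) ∧
        T3UnitScaleTilt.θBal F.L γ b p₀ (K - j) ≤ GaugeGroup.dist1 (GaugeField.plaqHol
          (Averaging.iter (fun i => BlockAveraging.blockAvg (P := F.P K) (j := i) T3UnitLawDensityEML.ℰp) j U) p)} ⊆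
      {U : GaugeField (F.P K) 0 (Matrix.specialUnitaryGroup (Fin 2) ℂ) |
        θ₀ ≤ GaugeGroup.dist1 (GaugeField.plaqHol (Averaging.iter (fun _ => BlockAveraging.blockAvg ℰp) j U) p)} := by
    intro U hU
    exact hθb_gt.le.trans hU.2.2
  refine (measureReal_mono hsub (measure_ne_top _ _)).trans ?_
  -- Step 2: the footprint cover
  obtain ⟨T, hTcard, hTbound⟩ := gibbsK_real_event_le_sum_footprint F hγ.le hjK hθ₀0 hθ₀2 p
  refine hTbound.trans ?_
  -- Step 3: the per-fine-plaquette chessboard bound (volume-uniform)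
  set a : ℝ := θ₀ / (151 * (F.L : ℝ) ^ 2) ^ j with ha
  have hΛL0 : 0 < 151 * (F.L : ℝ) ^ 2 := lam_pos F
  have hΛLj0 : 0 < (151 * (F.L : ℝ) ^ 2) ^ j := pow_pos hΛL0 j
  have ha0 : 0 ≤ a := div_nonneg hθ₀0 hΛLj0.le
  have hterm : ∀ q : Plaq (F.P K) 0,
      (gibbsK F ℰp γ K).real {U | a ≤ GaugeGroup.dist1 (GaugeField.plaqHol U q)} ≤
        2 * Real.exp 24 * (c₀ ^ 3)⁻¹ * Real.sqrt βK ^ 9 * Real.exp (-(βK * a ^ 2 / 4)) := by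
    intro q
    have hq := hch (F.P K) βK hβK1 a ha0 q
    rw [gibbsK_eq]
    refine hq.trans (le_of_eq ?_)
    rw [card_planePairs F K, show (F.P K).d = 3 from rfl]
    have hexp : βK * a ^ 2 / (2 * (2 : ℕ)) = βK * a ^ 2 / 4 := by norm_num
    rw [hexp]
    norm_num
  have hsum : ∑ q ∈ T, (gibbsK F ℰp γ K).real {U | θ₀ / (151 * (F.L : ℝ) ^ 2) ^ j ≤ GaugeGroup.dist1 (GaugeField.plaqHol U q)} ≤
      T.card * (2 * Real.exp 24 * (c₀ ^ 3)⁻¹ * Real.sqrt βK ^ 9 * Real.exp (-(βK * a ^ 2 / 4))) := by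
    have h := Finset.sum_le_sum fun q (_ : q ∈ T) => hterm q
    rwa [Finset.sum_const, nsmul_eq_mul] at h
  refine hsum.trans ?_
  -- Step 4 (i): the prefactor `#T·(√βK)⁹ ≤ (81L³)^j·L^{5j}·βi⁵ ≤ βi⁶`
  have hsqrt : Real.sqrt βK ^ 9 ≤ (F.L : ℝ) ^ (5 * j) * βi ^ 5 := by
    have hs1 : 1 ≤ Real.sqrt βK := by rw [← Real.sqrt_one]; exact Real.sqrt_le_sqrt hβK1
    have h9 : Real.sqrt βK ^ 9 ≤ Real.sqrt βK ^ 10 := pow_le_pow_right₀ hs1 (by norm_num)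
    have h10 : Real.sqrt βK ^ 10 = βK ^ 5 := by
      rw [show (10 : ℕ) = 2 * 5 from rfl, pow_mul, Real.sq_sqrt (zero_le_one.trans hβK1)]
    refine h9.trans (le_of_eq ?_)
    rw [h10, hβKeq, mul_pow, ← pow_mul, mul_comm j 5]
  have hpre : (T.card : ℝ) * Real.sqrt βK ^ 9 ≤ βi ^ 6 := by
    have h1 : (T.card : ℝ) * Real.sqrt βK ^ 9 ≤ (81 * (F.L : ℝ) ^ 3) ^ j * ((F.L : ℝ) ^ (5 * j) * βi ^ 5) :=
      mul_le_mul hTcard hsqrt (by positivity) (by positivity)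
    have h2 : (81 * (F.L : ℝ) ^ 3) ^ j * (F.L : ℝ) ^ (5 * j) ≤ (F.L : ℝ) ^ i := by
      have h3 : (81 * (F.L : ℝ) ^ 3) ^ j * (F.L : ℝ) ^ (5 * j) = (81 * (F.L : ℝ) ^ 3 * (F.L : ℝ) ^ 5) ^ j := by
        rw [pow_mul, ← mul_pow]
      rw [h3]
      calc (81 * (F.L : ℝ) ^ 3 * (F.L : ℝ) ^ 5) ^ j ≤ ((F.L : ℝ) ^ 15) ^ j :=
            pow_le_pow_left₀ (by positivity) (eightyone_mul_pow_le hL2) j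
        _ = (F.L : ℝ) ^ (15 * j) := by rw [← pow_mul]
        _ ≤ (F.L : ℝ) ^ i := pow_le_pow_right₀ hL1 (by omega)
    calc (T.card : ℝ) * Real.sqrt βK ^ 9 ≤ (81 * (F.L : ℝ) ^ 3) ^ j * ((F.L : ℝ) ^ (5 * j) * βi ^ 5) := h1
      _ = ((81 * (F.L : ℝ) ^ 3) ^ j * (F.L : ℝ) ^ (5 * j)) * βi ^ 5 := by ring
      _ ≤ (F.L : ℝ) ^ i * βi ^ 5 := mul_le_mul_of_nonneg_right h2 (by positivity)
      _ ≤ βi * βi ^ 5 := mul_le_mul_of_nonneg_right hLi_le (by positivity)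
      _ = βi ^ 6 := by ring
  -- Step 4 (ii): the exponent `βK a²/4 ≥ √βi/(4Λ²)`
  have hL19 : (F.L : ℝ) ^ (19 * j) ≤ Real.sqrt βi := by
    refine Real.le_sqrt_of_sq_le ?_
    calc ((F.L : ℝ) ^ (19 * j)) ^ 2 = (F.L : ℝ) ^ (38 * j) := by rw [← pow_mul]; ring_nf
      _ ≤ (F.L : ℝ) ^ i := pow_le_pow_right₀ hL1 hij
      _ ≤ βi := hLi_le
  have hΛsq : ((151 * (F.L : ℝ) ^ 2) ^ j) ^ 2 ≤ (F.L : ℝ) ^ (19 * j) * (F.L : ℝ) ^ j := by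
    calc ((151 * (F.L : ℝ) ^ 2) ^ j) ^ 2 = (151 * (F.L : ℝ) ^ 2) ^ (2 * j) := by rw [← pow_mul]; ring_nf
      _ ≤ ((F.L : ℝ) ^ 10) ^ (2 * j) := pow_le_pow_left₀ hΛL0.le (lam_le_pow_ten hL2) (2 * j)
      _ = (F.L : ℝ) ^ (19 * j) * (F.L : ℝ) ^ j := by rw [← pow_mul, ← pow_add]; ring_nf
  have hexp_ge : Real.sqrt βi / (4 * Λ ^ 2) ≤ βK * a ^ 2 / 4 := by
    have hβsqrt0 : 0 ≤ Real.sqrt βi := Real.sqrt_nonneg _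
    -- `βK a²/4 = L^j βi θ₀² / (4 (Λ_L^j)²)` and `θ₀² = (Λ²)⁻¹`
    have hrew : βK * a ^ 2 / 4 = (F.L : ℝ) ^ j * βi / (4 * Λ ^ 2 * ((151 * (F.L : ℝ) ^ 2) ^ j) ^ 2) := by
      rw [ha, hβKeq, hθ₀, div_pow, inv_pow]
      field_simp
    rw [hrew, div_le_div_iff₀ (by positivity) (by positivity)]
    -- `√βi · (4Λ²(Λ_L^j)²) ≤ L^j βi · 4Λ²`
    have hkey : Real.sqrt βi * ((151 * (F.L : ℝ) ^ 2) ^ j) ^ 2 ≤ (F.L : ℝ) ^ j * βi := by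
      calc Real.sqrt βi * ((151 * (F.L : ℝ) ^ 2) ^ j) ^ 2 ≤ Real.sqrt βi * ((F.L : ℝ) ^ (19 * j) * (F.L : ℝ) ^ j) :=
            mul_le_mul_of_nonneg_left hΛsq hβsqrt0
        _ = (F.L : ℝ) ^ j * (Real.sqrt βi * (F.L : ℝ) ^ (19 * j)) := by ring
        _ ≤ (F.L : ℝ) ^ j * (Real.sqrt βi * Real.sqrt βi) := by
            apply mul_le_mul_of_nonneg_left _ (by positivity)
            exact mul_le_mul_of_nonneg_left hL19 hβsqrt0
        _ = (F.L : ℝ) ^ j * βi := by rw [Real.mul_self_sqrt hβi0.le]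
    calc Real.sqrt βi * (4 * Λ ^ 2 * ((151 * (F.L : ℝ) ^ 2) ^ j) ^ 2)
        = (Real.sqrt βi * ((151 * (F.L : ℝ) ^ 2) ^ j) ^ 2) * (4 * Λ ^ 2) := by ring
      _ ≤ ((F.L : ℝ) ^ j * βi) * (4 * Λ ^ 2) := mul_le_mul_of_nonneg_right hkey (by positivity)
      _ = (F.L : ℝ) ^ j * βi * (4 * Λ ^ 2) := by ring
  -- Step 4 (iii): the printed exponent `p(g_i)² ≤ A·βi^{1/8} ≤ √βi/(4Λ²)`
  set t : ℝ := Real.log βi with ht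
  have ht0 : 0 ≤ t := Real.log_nonneg hβi1
  have hβexp : Real.exp t = βi := Real.exp_log hβi0
  have hsqrt_exp : Real.sqrt βi = Real.exp (t / 8) * Real.exp (3 * t / 8) := by
    rw [← Real.exp_add, show t / 8 + 3 * t / 8 = t * (1 / 2) by ring, Real.exp_mul, hβexp, Real.sqrt_eq_rpow]
  have hlogg : Real.log (Real.sqrt x)⁻¹ = t / 2 := by
    rw [Real.log_inv, Real.log_sqrt hx0.le, ht, hβi_eq, Real.log_inv]
    ring
  have hpg_le : pg ^ 2 ≤ A * Real.exp (t / 8) := by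
    have h := pFun_sq_le (b₀ := b₀) (g := Real.sqrt x) (by linarith : 0 < p₀) ht0 hlogg
    simpa [hpg, hA] using h
  have hQexp : Q ≤ Real.exp (3 * t / 8) := by
    -- `t ≥ 3 log Q`, so `3t/8 ≥ (9/8) log Q ≥ log Q`
    have hlogQ0 : 0 ≤ Real.log Q := Real.log_nonneg hQ1
    have htQ : 3 * Real.log Q ≤ t := by
      have h3 : Real.log (Q ^ 3) = 3 * Real.log Q := by
        rw [Real.log_pow]; norm_num
      rw [ht, ← h3]
      exact Real.log_le_log (by positivity) hβiQ
    calc Q = Real.exp (Real.log Q) := (Real.exp_log hQ0).symm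
      _ ≤ Real.exp (3 * t / 8) := Real.exp_le_exp.mpr (by linarith)
  have hpg_exp : pg ^ 2 ≤ βK * a ^ 2 / 4 := by
    refine le_trans ?_ hexp_ge
    rw [hsqrt_exp]
    have hA0 : 0 ≤ A := by positivity
    have hE8 : 0 ≤ Real.exp (t / 8) := (Real.exp_pos _).le
    -- `A e^{t/8} · 4Λ² ≤ e^{t/8} · Q ≤ e^{t/8} e^{3t/8}`
    rw [le_div_iff₀ (by positivity)]
    calc pg ^ 2 * (4 * Λ ^ 2) ≤ A * Real.exp (t / 8) * (4 * Λ ^ 2) := mul_le_mul_of_nonneg_right hpg_le (by positivity)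
      _ = Real.exp (t / 8) * (4 * Λ ^ 2 * A) := by ring
      _ ≤ Real.exp (t / 8) * Q := mul_le_mul_of_nonneg_left hQA hE8
      _ ≤ Real.exp (t / 8) * Real.exp (3 * t / 8) := mul_le_mul_of_nonneg_left hQexp hE8
  have hgauss : Real.exp (-(βK * a ^ 2 / 4)) ≤ Real.exp (-(1 * pg ^ 2)) := by
    rw [one_mul]
    exact Real.exp_le_exp.mpr (neg_le_neg hpg_exp)
  -- assemble
  have hpre0 : 0 ≤ 2 * Real.exp 24 * (c₀ ^ 3)⁻¹ := by positivity
  have hfinal : (T.card : ℝ) * (2 * Real.exp 24 * (c₀ ^ 3)⁻¹ * Real.sqrt βK ^ 9 * Real.exp (-(βK * a ^ 2 / 4))) ≤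
      2 * Real.exp 24 * (c₀ ^ 3)⁻¹ * βi ^ 6 * Real.exp (-(1 * pg ^ 2)) := by
    calc (T.card : ℝ) * (2 * Real.exp 24 * (c₀ ^ 3)⁻¹ * Real.sqrt βK ^ 9 * Real.exp (-(βK * a ^ 2 / 4)))
        = 2 * Real.exp 24 * (c₀ ^ 3)⁻¹ * ((T.card : ℝ) * Real.sqrt βK ^ 9) * Real.exp (-(βK * a ^ 2 / 4)) := by ring
      _ ≤ 2 * Real.exp 24 * (c₀ ^ 3)⁻¹ * βi ^ 6 * Real.exp (-(1 * pg ^ 2)) := by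
          gcongr
  rw [← hβi_eq]
  exact hfinal

end Main

end Summit.QuantumFields.YangMills.Theorems.CovariantDischargeSandwichLarge

end
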